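import Literature.Computability.Complexity.GateEliminationCase1

/-!
# Gate elimination, XIV: Cases 2 and 4 of the proof of Li–Yang's Theorem 4.1

Second and fourth cases of the one-step claim `LiYang2022_step` (Li–Yang, STOC 2022; full version
ECCC TR21-023, §4.1, Case 2: "There is a protected `0`-variable `p`. Suppose that its couple in
the quadratic equation is `q`. Then we perform constant substitution to `q`, making the quadratic
equation an affine one. Since both `p` and `q` becomes non-influential, we have `Δμ ≥ 2α_I ≥ δ`").
PROVED from the toolkit: one constant substitution to the couple (`assignProtected`,
`substConst`), no elimination; `p` (a `0`-variable, no longer protected) and `q` (no longer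
free) leave the influential inputs, a quadratic equation is killed, the potential does not grow;
`2α_I ≥ 4α_I/3 ≥ δ` (`liYangDelta_le_four_thirds`).

Case 4 ("There is an ∧-type gate `G` fed by two variables `x` and `y`, and `x` is a `1`-variable.
Note that both `x` and `y` are unprotected by Case 1. We perform appropriate constant substitution
to `y` such that `G` is trivialized, making both `x` and `y` non-influential. Hence
`Δμ ≥ 2α_I ≥ δ`"): `case4` — `y := c` (`assignFree`, `substConst`), then Rule 2 on `G` done by
hand (`redirect` to the constant `G` now computes, `removeGate`; `ΔΦ ≤ 1` by
`exists_packing_removeGate`) so as to track that `x` becomes a `0`-variable; one substitution,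
`Δμ ≥ 2α_I + (1 - α_φ) ≥ δ`.

## References

* J. Li, T. Yang, *3.1n − o(n) circuit lower bounds for explicit functions*, STOC 2022
  [LiYang2022]; full version ECCC TR21-023, §4.1 (Cases 2, 4), Thm. 4.1.
-/

namespace Literature.Computability.Complexity

open Finset

/-- `δ ≤ α_I + α_I / 3` (the first term of the minimum). [cite: LiYang2022, Thm. 4.1] -/
theorem liYangDelta_le_four_thirds (αφ αI αQ : ℝ) : liYangDelta αφ αI αQ ≤ αI + αI / 3 := by
  unfold liYangDelta
  have := min_le_left (αI / 3) (min (2 - 2 * αφ + αQ) (min (4 - 4 * αφ) (min (3 + αφ) (min (5 - αQ)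
      ((5 - 2 * αφ + αQ) / 2)))))
  linarith

namespace Semicircuit

variable {n : ℕ}

section Case2

variable {C : Semicircuit n} {f : (Fin n → ZMod 2) → Bool} {R : RdqSource n}
  {αφ αI αQ : ℝ} {P : Finset (Fin C.m × Fin C.m)}

/-- **Case 2 of Li–Yang's proof of Theorem 4.1**: "There is a protected `0`-variable `p`.
Suppose that its couple in the quadratic equation is `q`. Then we perform constant substitution to
`q`, making the quadratic equation an affine one. Since both `p` and `q` becomes non-influential,
we have `Δμ ≥ 2α_I ≥ δ`." Here: one substitution (`t = 1`), no gate eliminated; `p` and `q` leave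
the influential inputs (`q` is no longer free, `p` is a `0`-variable no longer protected), a
quadratic equation is killed, the potential does not increase. [cite: LiYang2022, §4.1 (Case 2)] -/
theorem case2 (hF : C.Fair) (hC : C.ComputesRestr f R) (hP : C.IsPacking P)
    (hφ : 0 ≤ αφ) (hI : 0 ≤ αI) (hQ : 0 ≤ αQ)
    {p l : Fin n} {e : QuadEq n} (he : R.quad l = some e) (hrp : e.Reads p) (hp0 : C.fanout (.var p) = 0) :
    C.StepBranch2 f R αφ αI αQ P := by
  classical
  -- the couple `q` of `p`
  have hik := (R.quad_wf l e he).2.2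
  have hrq : e.Reads (e.other p) := by
    unfold QuadEq.Reads QuadEq.other
    split_ifs with h
    · exact Or.inr rfl
    · exact Or.inl rfl
  have hpq : e.other p ≠ p := e.other_ne hrp hik
  set q := e.other p with hqdef
  let c : ZMod 2 := 0
  let R' := RdqSource.assignProtected he hrq c
  let C₁ := C.substConst q (finTwoEquiv c)
  have hF₁ : C₁.Fair := hF.substConst q _
  have hC₁ : C₁.ComputesRestr f (RdqSource.assignProtected he hrq c) := hC.substConst_assignProtected he hrq c
  have hP₁ : C₁.IsPacking (C.substConstPacking q (finTwoEquiv c) P) := hP.substConst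
  have hsub := measure_substConst_le hφ αI αQ hP R (RdqSource.assignProtected he hrq c) q (finTwoEquiv c)
  -- `p` and `q` are influential in `C` (protected) and not in `C₁`
  have hpinf : p ∈ C.influential R := by
    unfold influential; rw [mem_filter]
    exact ⟨mem_univ _, Or.inr (RdqSource.protected_of_reads he hrp)⟩
  have hqinf : q ∈ C.influential R := by
    unfold influential; rw [mem_filter]
    exact ⟨mem_univ _, Or.inr (RdqSource.protected_of_reads he hrq)⟩
  have hinf : (((C.substConst q (finTwoEquiv c)).influential (RdqSource.assignProtected he hrq c)).card : ℝ) + 2 ≤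
      (C.influential R).card := by
    have h1 := C.influential_substConst_assignProtected_subset he hrq c (finTwoEquiv c)
    have h2 : ((C.influential R).erase q).filter (fun i => e.Reads i → 1 ≤ C.fanout (.var i)) ⊆
        ((C.influential R).erase q).erase p := by
      intro i hi
      rw [mem_filter] at hi
      rw [mem_erase]
      refine ⟨fun hip => ?_, hi.1⟩
      subst hip
      have := hi.2 hrp
      omega
    have h3 := card_le_card (h1.trans h2)
    have h4 : p ∈ (C.influential R).erase q := mem_erase.mpr ⟨hpq.symm, hpinf⟩
    have h5 := card_erase_of_mem h4
    have h6 := card_erase_of_mem hqinf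
    have h7 := card_pos.mpr ⟨p, h4⟩
    have h8 := card_pos.mpr ⟨q, hqinf⟩
    have : ((C.substConst q (finTwoEquiv c)).influential (RdqSource.assignProtected he hrq c)).card + 2 ≤
        (C.influential R).card := by omega
    exact_mod_cast this
  have hq : ((R.quadCount : ℝ)) - (RdqSource.assignProtected he hrq c).quadCount = 1 := by
    have := RdqSource.quadCount_assignProtected he hrq c
    have h : ((RdqSource.assignProtected he hrq c).quadCount : ℝ) + 1 = R.quadCount := by exact_mod_cast this
    linarith
  refine ⟨1, le_rfl, by norm_num, C₁, RdqSource.assignProtected he hrq c, C.substConstPacking q (finTwoEquiv c) P,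
    hF₁, hC₁, hP₁, RdqSource.dim_assignProtected he hrq c, ?_⟩
  have hδ := liYangDelta_le_four_thirds αφ αI αQ
  simp only [Nat.cast_one, mul_one]
  rw [hq, mul_one] at hsub
  have h1 : 2 * αI ≤ αI * (((C.influential R).card : ℝ) -
      ((C.substConst q (finTwoEquiv c)).influential (RdqSource.assignProtected he hrq c)).card) := by
    have h2 : (2 : ℝ) ≤ ((C.influential R).card : ℝ) -
        ((C.substConst q (finTwoEquiv c)).influential (RdqSource.assignProtected he hrq c)).card := by linarith
    have := mul_le_mul_of_nonneg_left h2 hI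
    linarith
  show liYangDelta αφ αI αQ ≤ C.measure αφ αI αQ P R -
    C₁.measure αφ αI αQ (C.substConstPacking q (finTwoEquiv c) P) (RdqSource.assignProtected he hrq c)
  linarith

end Case2

section Case4

variable {C : Semicircuit n} {f : (Fin n → ZMod 2) → Bool} {R : RdqSource n} {d : ℕ}
  {αφ αI αQ : ℝ} {P : Finset (Fin C.m × Fin C.m)}

/-- **Case 4 of Li–Yang's proof of Theorem 4.1**: "There is an ∧-type gate `G` fed by two
variables `x` and `y`, and `x` is a `1`-variable. Note that both `x` and `y` are unprotected by
Case 1. We perform appropriate constant substitution to `y` such that `G` is trivialized, making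
both `x` and `y` non-influential. Hence `Δμ ≥ 2α_I ≥ δ`." Here: `y := c` (the constant
trivializing `G`, an unprotected free variable: `assignFree`), then `G` — fed by a constant,
trivialized, not the output — is removed by Rule 2 (its readers read the constant it computes,
the `0`-gate is deleted, `ΔΦ ≤ 1`); afterwards `x` is a `0`-variable. One substitution,
`Δμ ≥ 2α_I + (1 - α_φ) ≥ δ`. [cite: LiYang2022, §4.1 (Case 4)] -/
theorem case4 (hf : IsAffineDisperser f d) (hd : 2 * d + 2 < R.dim) (hF : C.Fair)
    (hC : C.ComputesRestr f R) (hP : C.IsPacking P) (hφ : 0 ≤ αφ) (hφ1 : αφ ≤ 1) (hI : 0 ≤ αI) (αQ : ℝ)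
    {G : Fin C.m} {x y : Fin n} (hxy : x ≠ y) {ax ay : Fin 2} (hax : C.arg G ax = .var x)
    (hay : C.arg G ay = .var y) (haxy : ax ≠ ay) (hand : IsAndOp (C.op G))
    (hx1 : C.fanout (.var x) = 1) (hxu : ¬ R.Protected x) (hyfree : R.Free y) (hyu : ¬ R.Protected y) :
    C.StepBranch2 f R αφ αI αQ P := by
  classical
  obtain ⟨c₁, c₂, c₃, hop⟩ := hand
  -- the constant trivializing `G` at position `ay`
  let bG : Bool := if ay = 0 then c₁ else c₂
  have hbG : bG = if ay = 0 then c₁ else c₂ := rfl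
  let c : ZMod 2 := finTwoEquiv.symm bG
  have hb : finTwoEquiv c = bG := finTwoEquiv.apply_symm_apply bG
  let R' := R.assignFree y c hyfree hyu
  let C₁ := C.substConst y (finTwoEquiv c)
  have hF₁ : C₁.Fair := hF.substConst y _
  have hC₁ : C₁.ComputesRestr f (R.assignFree y c hyfree hyu) := hC.substConst_assignFree hyfree hyu c
  have hP₁ : C₁.IsPacking (C.substConstPacking y (finTwoEquiv c) P) := hP.substConst
  have hd' : 2 * d + 2 ≤ (R.assignFree y c hyfree hyu).dim := by
    have := RdqSource.dim_assignFree (b := c) hyfree hyu; omega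
  -- `G` in `C₁`: fed by the constant at `ay`, trivialized, reads `x` at `ax`
  have h₀ : C₁.arg G ay = .const bG := by
    show (C.arg G ay).substConst y (finTwoEquiv c) = .const bG
    rw [hay, Node.substConst_var_self, hb]
  have hGx : C₁.arg G ax = .var x := by
    show (C.arg G ax).substConst y (finTwoEquiv c) = .var x
    rw [hax, Node.substConst_var_of_ne hxy]
  have hrev : ay.rev = ax := by
    obtain rfl | rfl : ay = 0 ∨ ay = 1 := by fin_cases ay <;> simp
    all_goals obtain rfl | rfl : ax = 0 ∨ ax = 1 := by fin_cases ax <;> simp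
    all_goals first | exact absurd rfl haxy | rfl
  have htriv : C₁.liveFn G ay bG false = C₁.liveFn G ay bG true := by
    show C.liveFn G ay bG false = C.liveFn G ay bG true
    unfold liveFn
    obtain rfl | rfl : ay = 0 ∨ ay = 1 := by fin_cases ay <;> simp
    · rw [if_pos rfl, if_pos rfl, hop, hop, hbG, if_pos rfl]
      cases c₁ <;> cases c₂ <;> cases c₃ <;> rfl
    · rw [if_neg (by decide), if_neg (by decide), hop, hop, hbG, if_neg (by decide)]
      cases c₁ <;> cases c₂ <;> cases c₃ <;> rfl
  have hself : ∀ a, C₁.arg G a ≠ .gate G := hF₁.not_reads_self_of_const h₀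
  have hout : C₁.out ≠ .gate G := out_ne_of_trivialized hf (by omega) hF₁ hC₁ h₀ htriv
  have hk₀ : ¬ C₁.Troubled G := not_troubled_of_reads_const h₀
  -- Rule 2 by hand: readers read the constant `cG`, then delete the `0`-gate `G`
  let cG := C₁.liveFn G ay bG false
  have hid : ∀ (x' : Fin n → Bool) (w : Fin C.m → Bool),
      C₁.op G (C₁.nodeVal x' w (C₁.arg G 0)) (C₁.nodeVal x' w (C₁.arg G 1)) =
        (C₁.nodeVal x' w (.const cG) ^^ false) := by
    intro x' w
    rw [op_eq_liveFn h₀, Bool.xor_false]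
    show _ = C₁.liveFn G ay bG false
    cases C₁.nodeVal x' w (C₁.arg G ay.rev)
    · rfl
    · exact htriv.symm
  have hv := C₁.redirectOK_const G cG
  let C₂ := C₁.redirect G (.const cG) false hv
  have hF₂ : C₂.Fair := hF₁.redirect hself hid
  have hC₂ : C₂.ComputesRestr f (R.assignFree y c hyfree hyu) := hC₁.redirect hself hid (fun i h => by cases h)
  obtain ⟨hP₂, hμ₂⟩ := C₁.measure_redirect_const' G hk₀ cG false αφ αI αQ hP₁ (R.assignFree y c hyfree hyu)
  have h0₂ : ∀ k a, C₂.arg k a ≠ .gate G :=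
    (fanout_eq_zero_iff _ _).mp (C₁.fanout_redirect_self G _ false hv (fun h => by cases h))
  have hargs₂ : ∀ a, C₂.arg G a = C₁.arg G a := fun a => by
    show (if C₁.arg G a = .gate G then Node.const cG else C₁.arg G a) = _; rw [if_neg (hself a)]
  let ε := C₂.skipEquiv G
  obtain ⟨P₃, hP₃, hpot₃⟩ := C₂.exists_packing_removeGate G ε h0₂ hP₂
  have hout₂ : C₂.out ≠ .gate G := hout
  let C₃ := C₂.removeGate G ε
  have hF₃ : C₃.Fair := hF₂.removeGate ε h0₂
  have hC₃ : C₃.ComputesRestr f (R.assignFree y c hyfree hyu) := hC₂.removeGate ε hF₂ h0₂ hout₂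
  -- potential: `Φ₃ ≤ Φ₂ + 1 = Φ₁ + 1 ≤ Φ + 1`
  have hcost : (((univ : Finset (Fin 2)).filter fun a => ∀ b, C₂.arg G a ≠ .const b).card : ℝ) ≤ 1 := by
    exact_mod_cast C₂.card_nonconst_inputs_le_one G (a₀ := ay) (b := bG) (by rw [hargs₂, h₀])
  have hpot₂ : C₂.potential (C.substConstPacking y (finTwoEquiv c) P) =
      C₁.potential (C.substConstPacking y (finTwoEquiv c) P) := by
    unfold potential
    rw [show C₂.troubledCount = C₁.troubledCount from by
      classical
      unfold troubledCount
      exact congrArg Finset.card (filter_congr fun k _ => C₁.troubled_redirect_const_iff' G hk₀ cG false k)]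
  have hpot₁ := potential_substConst_le (j := y) (b := finTwoEquiv c) hP
  -- influential: `x` and `y` are gone
  have hfx₃ : C₃.fanout (.var x) = 0 := by
    have h1 := C₂.fanout_removeGate_var_add G ε h0₂ x
    have h2 : C₂.fanout (.var x) = C₁.fanout (.var x) :=
      C₁.fanout_redirect_of_ne G (.const cG) false hv (by simp) (fun h => by cases h)
    have h3 : C₁.fanout (.var x) = C.fanout (.var x) := C.fanout_substConst_var_of_ne y _ hxy
    have h4 : 1 ≤ (univ.filter fun a : Fin 2 => C₂.arg G a = .var x).card :=
      card_pos.mpr ⟨ax, mem_filter.mpr ⟨mem_univ _, by rw [hargs₂, hGx]⟩⟩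
    rw [h2, h3, hx1] at h1
    show (C₂.removeGate G ε).fanout (.var x) = 0
    omega
  have hinf₃ : C₃.influential (R.assignFree y c hyfree hyu) ⊆ ((C.influential R).erase y).erase x := by
    intro i hi
    have hi₂ : i ∈ C₂.influential (R.assignFree y c hyfree hyu) := C₂.influential_removeGate_subset G ε h0₂ _ hi
    rw [C₁.influential_redirect_const G cG false] at hi₂
    have hi₀ := C.influential_substConst_assignFree_subset hyfree hyu c (finTwoEquiv c) hi₂
    rw [mem_erase]
    refine ⟨fun hix => ?_, hi₀⟩
    subst hix
    unfold influential at hi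
    rw [mem_filter] at hi
    rcases hi.2 with h | h
    · omega
    · exact hxu ((RdqSource.protected_assignFree_iff hyfree hyu i).mp h)
  have hxinf : x ∈ (C.influential R).erase y := by
    rw [mem_erase]
    refine ⟨hxy, ?_⟩
    unfold influential; rw [mem_filter]; exact ⟨mem_univ _, Or.inl (by omega)⟩
  have hyinf : y ∈ C.influential R := by
    unfold influential; rw [mem_filter]
    refine ⟨mem_univ _, Or.inl ?_⟩
    -- `y` is read by `G`
    unfold fanout
    refine Nat.one_le_iff_ne_zero.mpr fun hsum => ?_
    have := (sum_eq_zero_iff.mp hsum) G (mem_univ _)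
    rw [card_eq_zero, filter_eq_empty_iff] at this
    exact this (mem_univ ay) hay
  have hcard : ((C₃.influential (R.assignFree y c hyfree hyu)).card : ℝ) + 2 ≤ (C.influential R).card := by
    have h1 := card_le_card hinf₃
    have h2 := card_erase_of_mem hxinf
    have h3 := card_erase_of_mem hyinf
    have h4 := card_pos.mpr ⟨x, hxinf⟩
    have h5 := card_pos.mpr ⟨y, hyinf⟩
    have : (C₃.influential (R.assignFree y c hyfree hyu)).card + 2 ≤ (C.influential R).card := by omega
    exact_mod_cast this
  have hm₃ : ((C₃.m : ℕ) : ℝ) + 1 = C.m := by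
    have := C₂.removeGate_m_add_one G ε
    exact_mod_cast this
  -- assemble
  refine ⟨1, le_rfl, by norm_num, C₃, R.assignFree y c hyfree hyu, P₃, hF₃, hC₃, hP₃,
    RdqSource.dim_assignFree hyfree hyu, ?_⟩
  have hδ := liYangDelta_le_four_thirds αφ αI αQ
  simp only [Nat.cast_one, mul_one]
  have hq : ((R.assignFree y c hyfree hyu).quadCount : ℝ) = R.quadCount := by
    rw [RdqSource.quadCount_assignFree]
  have hμ₃ : C₃.measure αφ αI αQ P₃ (R.assignFree y c hyfree hyu) ≤
      C.measure αφ αI αQ P R - 1 - 2 * αI + αφ := by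
    unfold measure
    rw [hq]
    have e1 : αI * ((C₃.influential (R.assignFree y c hyfree hyu)).card : ℝ) ≤ αI * (C.influential R).card - 2 * αI := by
      nlinarith [mul_le_mul_of_nonneg_left hcard hI]
    have e2 : αφ * C₃.potential P₃ ≤ αφ * C.potential P + αφ := by
      have : C₃.potential P₃ ≤ C.potential P + 1 := by
        have := hpot₃; rw [hpot₂] at this; linarith
      nlinarith [mul_le_mul_of_nonneg_left this hφ]
    linarith
  linarith

end Case4

end Semicircuit

end Literature.Computability.Complexity
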